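import Summits.Ventures.PercRepro.MSTightUpDown
import Summits.Ventures.PercRepro.MSTightBadExtension

/-!
# Members of a tight twin-free family built from its addable part

Dossier proofs/MINE1-theoremS.md, Addendum 54 supplement 3. Theorem S writes a tight family `P`
as the product of its flipped members outside the addable part `R = Rstar P` and the complements
within `R` of its flipped members inside `R` (`tight_eq_sups_of_tight`). For a twin-free `P` this
gives explicit members:

* `Rstar_union_singleton_mem`: `R ∪ {a} ∈ P` for a removable element `a` of the support;
* `Rstar_erase_mem`: `R.erase b ∈ P` for an addable element `b` of the support;
* `singleton_union_inter_Rstar_mem`: `{a} ∪ (q ∩ R) ∈ P` for removable `a` and any member `q`;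
* `inter_Rstar_mem`: `q ∩ R ∈ P` for every member `q`;
* `exists_mem_notMem_of_ne`: for `a` on the support and `b ≠ a` outside the core, some member
  contains `a` and not `b` — the core of the members containing `a` is `{a}` up to the core of `P`;
* `exists_mem_inter_Rstar_notMem_core`: if `P` has no minimum member, every member `q` has an
  element of `q ∩ R` outside the core.
-/

namespace PercRepro.MSTight

open Finset
open scoped FinsetFamily symmDiff

variable {α : Type*} [DecidableEq α] [Fintype α]

omit [Fintype α] in
/-- A flip member is determined by the member it comes from. -/
theorem eq_symmDiff_of_symmDiff_eq {A R W : Finset α} (h : A ∆ R = W) : A = W ∆ R := by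
  rw [← h, symmDiff_symmDiff_cancel_right]

/-- The singleton of an element of the support is a flip member. -/
theorem singleton_mem_flip_of_twinFree {P : Finset (Finset α)} (hP : Tight P)
    (htf : ∀ a b, Twin P a b → a = b) {a : α} (hin : ∃ p ∈ P, a ∈ p) (hout : ∃ p ∈ P, a ∉ p) :
    ({a} : Finset α) ∈ flip (Rstar P) P := by
  obtain ⟨p₁, hp₁, ha₁⟩ := hin
  obtain ⟨p₀, hp₀, ha₀⟩ := hout
  rw [← diffs_eq_flip_of_tight hP, ← cls_eq_singleton_of_twinFree htf a]
  exact cls_mem_diffs_of_tight hP hp₁ ha₁ hp₀ ha₀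

/-- `R ∪ {a} ∈ P` for a removable element `a` of the support. -/
theorem Rstar_union_singleton_mem {P : Finset (Finset α)} (hP : Tight P)
    (htf : ∀ a b, Twin P a b → a = b) {a : α} (hin : ∃ p ∈ P, a ∈ p) (hout : ∃ p ∈ P, a ∉ p)
    (haR : a ∉ Rstar P) : Rstar P ∪ {a} ∈ P := by
  obtain ⟨A, hA, hAa⟩ := mem_flip.1 (singleton_mem_flip_of_twinFree hP htf hin hout)
  have e : A = Rstar P ∪ {a} := by
    rw [eq_symmDiff_of_symmDiff_eq hAa]
    ext x
    simp only [mem_symmDiff, mem_singleton, mem_union]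
    constructor
    · rintro (⟨rfl, hx⟩ | ⟨hx, hx'⟩)
      · exact Or.inr rfl
      · exact Or.inl hx
    · rintro (hx | rfl)
      · exact Or.inr ⟨hx, fun h => haR (h ▸ hx)⟩
      · exact Or.inl ⟨rfl, haR⟩
  rw [← e]
  exact hA

/-- `R.erase b ∈ P` for an addable element `b` of the support. -/
theorem Rstar_erase_mem {P : Finset (Finset α)} (hP : Tight P)
    (htf : ∀ a b, Twin P a b → a = b) {b : α} (hin : ∃ p ∈ P, b ∈ p) (hout : ∃ p ∈ P, b ∉ p)
    (hbR : b ∈ Rstar P) : (Rstar P).erase b ∈ P := by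
  obtain ⟨A, hA, hAb⟩ := mem_flip.1 (singleton_mem_flip_of_twinFree hP htf hin hout)
  have e : A = (Rstar P).erase b := by
    rw [eq_symmDiff_of_symmDiff_eq hAb]
    ext x
    simp only [mem_symmDiff, mem_singleton, mem_erase]
    constructor
    · rintro (⟨rfl, hx⟩ | ⟨hx, hx'⟩)
      · exact absurd hbR hx
      · exact ⟨hx', hx⟩
    · rintro ⟨hxb, hxR⟩
      exact Or.inr ⟨hxR, hxb⟩
  rw [← e]
  exact hA

/-- The part of a member inside the addable part is the complement within `R` of a flip member
inside `R`. -/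
theorem inter_Rstar_mem_complWithin {P : Finset (Finset α)} (hP : Tight P) {q : Finset α}
    (hq : q ∈ P) :
    q ∩ Rstar P ∈ complWithin (Rstar P) (within (flip (Rstar P) P) (Rstar P)) := by
  have hD := dichotomy_of_tight hP
  have h1 : Rstar P \ q ∈ flip (Rstar P) P := by
    have h2 : (q ∆ Rstar P) ∩ Rstar P ∈ flip (Rstar P) P :=
      mem_flip_of_subset_of_twinClosed hD (symmDiff_mem_flip hq) inter_subset_left
        ((twinClosed_of_mem_flip (symmDiff_mem_flip hq)).inter (twinClosed_Rstar P))
    have e : (q ∆ Rstar P) ∩ Rstar P = Rstar P \ q := by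
      ext x
      simp only [mem_symmDiff, mem_inter, mem_sdiff]
      tauto
    rwa [e] at h2
  refine mem_complWithin.2 ⟨Rstar P \ q, mem_within.2 ⟨h1, sdiff_subset⟩, ?_⟩
  ext x
  simp only [mem_sdiff, mem_inter]
  tauto

/-- `{a} ∪ (q ∩ R) ∈ P` for a removable element `a` of the support and any member `q`. -/
theorem singleton_union_inter_Rstar_mem {P : Finset (Finset α)} (hP : Tight P)
    (htf : ∀ a b, Twin P a b → a = b) {a : α} (hin : ∃ p ∈ P, a ∈ p) (hout : ∃ p ∈ P, a ∉ p)
    (haR : a ∉ Rstar P) {q : Finset α} (hq : q ∈ P) : {a} ∪ (q ∩ Rstar P) ∈ P := by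
  have hX : ({a} : Finset α) ∈ within (flip (Rstar P) P) (Finset.univ \ Rstar P) :=
    mem_within.2 ⟨singleton_mem_flip_of_twinFree hP htf hin hout,
      singleton_subset_iff.2 (mem_sdiff.2 ⟨mem_univ a, haR⟩)⟩
  have hY := inter_Rstar_mem_complWithin hP hq
  have hmem : {a} ∪ (q ∩ Rstar P) ∈ within (flip (Rstar P) P) (Finset.univ \ Rstar P) ⊻
      complWithin (Rstar P) (within (flip (Rstar P) P) (Rstar P)) :=
    mem_sups.2 ⟨{a}, hX, q ∩ Rstar P, hY, rfl⟩
  rwa [← tight_eq_sups_of_tight hP] at hmem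

/-- `q ∩ R ∈ P` for every member `q`. -/
theorem inter_Rstar_mem {P : Finset (Finset α)} (hP : Tight P) {q : Finset α} (hq : q ∈ P) :
    q ∩ Rstar P ∈ P := by
  have hX : (∅ : Finset α) ∈ within (flip (Rstar P) P) (Finset.univ \ Rstar P) := by
    refine mem_within.2 ⟨?_, empty_subset _⟩
    have h0 : Rstar P ∆ Rstar P ∈ flip (Rstar P) P :=
      symmDiff_mem_flip (Rstar_mem_of_dichotomy (dichotomy_of_tight hP) ⟨q, hq⟩)
    rwa [symmDiff_self] at h0
  have hY := inter_Rstar_mem_complWithin hP hq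
  have hmem : q ∩ Rstar P ∈ within (flip (Rstar P) P) (Finset.univ \ Rstar P) ⊻
      complWithin (Rstar P) (within (flip (Rstar P) P) (Rstar P)) :=
    mem_sups.2 ⟨∅, hX, q ∩ Rstar P, hY, by simp⟩
  rwa [← tight_eq_sups_of_tight hP] at hmem

/-- For `a` on the support and `b ≠ a` outside the core, some member contains `a` but not `b`. -/
theorem exists_mem_notMem_of_ne {P : Finset (Finset α)} (hP : Tight P)
    (htf : ∀ a b, Twin P a b → a = b) {a b : α} (hin : ∃ p ∈ P, a ∈ p) (hout : ∃ p ∈ P, a ∉ p)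
    (hbout : ∃ p ∈ P, b ∉ p) (hab : b ≠ a) : ∃ p ∈ P, a ∈ p ∧ b ∉ p := by
  have hRP : Rstar P ∈ P := Rstar_mem_of_dichotomy (dichotomy_of_tight hP) (by
    obtain ⟨p, hp, -⟩ := hin
    exact ⟨p, hp⟩)
  by_cases haR : a ∈ Rstar P
  · by_cases hbR : b ∈ Rstar P
    · refine ⟨(Rstar P).erase b, Rstar_erase_mem hP htf ⟨Rstar P, hRP, hbR⟩ hbout hbR,
        mem_erase.2 ⟨hab.symm, haR⟩, notMem_erase b _⟩
    · exact ⟨Rstar P, hRP, haR, hbR⟩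
  · by_cases hbR : b ∈ Rstar P
    · have hRb : (Rstar P).erase b ∈ P := Rstar_erase_mem hP htf ⟨Rstar P, hRP, hbR⟩ hbout hbR
      refine ⟨{a} ∪ ((Rstar P).erase b ∩ Rstar P),
        singleton_union_inter_Rstar_mem hP htf hin hout haR hRb, mem_union_left _ (mem_singleton_self a), ?_⟩
      simp only [mem_union, mem_singleton, mem_inter, mem_erase, not_or, not_and]
      exact ⟨hab, fun h => absurd h.1 (fun h' => h' rfl)⟩
    · refine ⟨Rstar P ∪ {a}, Rstar_union_singleton_mem hP htf hin hout haR,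
        mem_union_right _ (mem_singleton_self a), ?_⟩
      simp only [mem_union, mem_singleton, not_or]
      exact ⟨hbR, hab⟩

/-- If `P` has no minimum member, every member `q` has an element of `q ∩ R` outside the core. -/
theorem exists_mem_inter_Rstar_notMem_core {P : Finset (Finset α)} (hP : Tight P)
    (hmin : ∀ t ∈ P, ∃ p ∈ P, ¬ t ⊆ p) {q : Finset α} (hq : q ∈ P) :
    ∃ e ∈ q ∩ Rstar P, ∃ p ∈ P, e ∉ p := by
  by_contra h
  push Not at h
  obtain ⟨p, hp, hsub⟩ := hmin (q ∩ Rstar P) (inter_Rstar_mem hP hq)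
  exact hsub fun e he => h e he p hp

/-- The part of a member outside the addable part is a flip member outside `R`. -/
theorem sdiff_Rstar_mem_within {P : Finset (Finset α)} (hP : Tight P) {q : Finset α}
    (hq : q ∈ P) : q \ Rstar P ∈ within (flip (Rstar P) P) (Finset.univ \ Rstar P) := by
  have hD := dichotomy_of_tight hP
  have h2 : (q ∆ Rstar P) \ Rstar P ∈ flip (Rstar P) P :=
    mem_flip_of_subset_of_twinClosed hD (symmDiff_mem_flip hq) sdiff_subset
      ((twinClosed_of_mem_flip (symmDiff_mem_flip hq)).sdiff (twinClosed_Rstar P))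
  have e : (q ∆ Rstar P) \ Rstar P = q \ Rstar P := by
    ext x
    simp only [mem_symmDiff, mem_sdiff]
    tauto
  rw [e] at h2
  exact mem_within.2 ⟨h2, fun x hx => mem_sdiff.2 ⟨mem_univ x, (mem_sdiff.1 hx).2⟩⟩

/-- `q ∪ R ∈ P` for every member `q`. -/
theorem mem_union_Rstar_of_mem {P : Finset (Finset α)} (hP : Tight P) {q : Finset α} (hq : q ∈ P) :
    q ∪ Rstar P ∈ P := by
  have hX := sdiff_Rstar_mem_within hP hq
  have hY : Rstar P ∈ complWithin (Rstar P) (within (flip (Rstar P) P) (Rstar P)) := by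
    refine mem_complWithin.2 ⟨∅, mem_within.2 ⟨?_, empty_subset _⟩, sdiff_empty⟩
    have h0 : Rstar P ∆ Rstar P ∈ flip (Rstar P) P :=
      symmDiff_mem_flip (Rstar_mem_of_dichotomy (dichotomy_of_tight hP) ⟨q, hq⟩)
    rwa [symmDiff_self] at h0
  have hmem : (q \ Rstar P) ∪ Rstar P ∈ within (flip (Rstar P) P) (Finset.univ \ Rstar P) ⊻
      complWithin (Rstar P) (within (flip (Rstar P) P) (Rstar P)) :=
    mem_sups.2 ⟨q \ Rstar P, hX, Rstar P, hY, rfl⟩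
  rw [← tight_eq_sups_of_tight hP] at hmem
  have e : (q \ Rstar P) ∪ Rstar P = q ∪ Rstar P := by
    ext x
    simp only [mem_union, mem_sdiff]
    tauto
  rwa [e] at hmem

/-- `(q \ R) ∪ R.erase a ∈ P` for an addable element `a` of the support and any member `q`. -/
theorem sdiff_Rstar_union_erase_mem {P : Finset (Finset α)} (hP : Tight P)
    (htf : ∀ a b, Twin P a b → a = b) {a : α} (hin : ∃ p ∈ P, a ∈ p) (hout : ∃ p ∈ P, a ∉ p)
    (haR : a ∈ Rstar P) {q : Finset α} (hq : q ∈ P) : (q \ Rstar P) ∪ (Rstar P).erase a ∈ P := by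
  have hX := sdiff_Rstar_mem_within hP hq
  have hY : (Rstar P).erase a ∈ complWithin (Rstar P) (within (flip (Rstar P) P) (Rstar P)) := by
    refine mem_complWithin.2 ⟨{a}, mem_within.2 ⟨singleton_mem_flip_of_twinFree hP htf hin hout,
      singleton_subset_iff.2 haR⟩, ?_⟩
    ext x
    simp only [mem_sdiff, mem_singleton, mem_erase]
    tauto
  have hmem : (q \ Rstar P) ∪ (Rstar P).erase a ∈ within (flip (Rstar P) P) (Finset.univ \ Rstar P) ⊻
      complWithin (Rstar P) (within (flip (Rstar P) P) (Rstar P)) :=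
    mem_sups.2 ⟨q \ Rstar P, hX, (Rstar P).erase a, hY, rfl⟩
  rwa [← tight_eq_sups_of_tight hP] at hmem

/-- If `P` has no maximum member, every member `q` has an element outside `q ∪ R` lying in some
member. -/
theorem exists_notMem_union_Rstar_mem {P : Finset (Finset α)} (hP : Tight P)
    (hmax : ∀ t ∈ P, ∃ p ∈ P, ¬ p ⊆ t) {q : Finset α} (hq : q ∈ P) :
    ∃ e, e ∉ q ∪ Rstar P ∧ ∃ p ∈ P, e ∈ p := by
  obtain ⟨p, hp, hsub⟩ := hmax (q ∪ Rstar P) (mem_union_Rstar_of_mem hP hq)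
  obtain ⟨e, hep, heq⟩ := not_subset.1 hsub
  exact ⟨e, heq, p, hp, hep⟩

/-- **MinInsert.** In a tight family `T`, a minimal member `m` plus an element `g ∉ m` whose twin
class is `{g}` and which some member contains is again a member (the mirror of MaxErase). -/
theorem insert_mem_of_tight_of_minimal {T : Finset (Finset α)} (hT : Tight T) {m : Finset α}
    (hm : m ∈ T) (hmin : ∀ A ∈ T, A ⊆ m → A = m) {g : α} (hgm : g ∉ m) (hcls : cls T g = {g})
    (hin : ∃ A ∈ T, g ∈ A) : insert g m ∈ T := by
  set R := Rstar T with hR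
  have hD := dichotomy_of_tight hT
  -- `m ⊆ R`: a removable class meets `m` in nothing (minimality)
  have hmR : m ⊆ R := by
    intro a ha
    by_contra haR
    have hrem : ClosedRem T (cls T a) := closedRem_of_notMem_Rstar hD haR
    have h1 : m \ cls T a ∈ T := hrem m hm
    have h2 : m \ cls T a = m := hmin _ h1 sdiff_subset
    have h3 : a ∈ m \ cls T a := by
      rw [h2]
      exact ha
    exact (mem_sdiff.1 h3).2 (mem_cls.2 (twin_refl T a))
  have hmR' : m ∆ R = R \ m := by
    ext x
    simp only [mem_symmDiff, mem_sdiff]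
    constructor
    · rintro (⟨hxm, hxR⟩ | h)
      · exact absurd (hmR hxm) hxR
      · exact h
    · intro h
      exact Or.inr h
  have hW : R \ m ∈ flip R T := by
    rw [← hmR']
    exact symmDiff_mem_flip hm
  suffices hsuff : (insert g m) ∆ R ∈ flip R T by
    obtain ⟨A, hA, hAR⟩ := mem_flip.1 hsuff
    have : A = insert g m := by
      have h := congrArg (fun S => S ∆ R) hAR
      simpa only [symmDiff_symmDiff_cancel_right] using h
    rw [← this]
    exact hA
  by_cases hgR : g ∈ R
  · have e : (insert g m) ∆ R = (R \ m).erase g := by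
      ext x
      simp only [mem_symmDiff, mem_insert, mem_sdiff, mem_erase, not_or]
      constructor
      · rintro (⟨hx, hxR⟩ | ⟨hxR, hxg, hxm⟩)
        · rcases hx with rfl | hxm
          · exact absurd hgR hxR
          · exact absurd (hmR hxm) hxR
        · exact ⟨hxg, hxR, hxm⟩
      · rintro ⟨hxg, hxR, hxm⟩
        exact Or.inr ⟨hxR, hxg, hxm⟩
    rw [e]
    exact mem_flip_of_subset_of_twinClosed hD hW (erase_subset g _)
      (twinClosed_erase (twinClosed_of_mem_flip hW) hcls)
  · obtain ⟨A, hA, hgA⟩ := hin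
    have hg1 : ({g} : Finset α) ∈ flip R T := by
      rw [← diffs_eq_flip_of_tight hT, ← hcls]
      exact cls_mem_diffs_of_tight hT hA hgA hm hgm
    have hX : ({g} : Finset α) ∈ within (flip R T) (Finset.univ \ R) :=
      mem_within.2 ⟨hg1, singleton_subset_iff.2 (mem_sdiff.2 ⟨mem_univ g, hgR⟩)⟩
    have hY : R \ m ∈ within (flip R T) R := mem_within.2 ⟨hW, sdiff_subset⟩
    have hmem : {g} ∪ (R \ m) ∈ flip R T := by
      rw [flip_eq_sups_within_of_tight hT]
      exact mem_sups.2 ⟨{g}, hX, R \ m, hY, rfl⟩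
    have e : (insert g m) ∆ R = {g} ∪ (R \ m) := by
      ext x
      simp only [mem_symmDiff, mem_insert, mem_sdiff, mem_union, mem_singleton, not_or]
      constructor
      · rintro (⟨hx, hxR⟩ | ⟨hxR, hxg, hxm⟩)
        · rcases hx with rfl | hxm
          · exact Or.inl rfl
          · exact absurd (hmR hxm) hxR
        · exact Or.inr ⟨hxR, hxm⟩
      · rintro (rfl | ⟨hxR, hxm⟩)
        · exact Or.inl ⟨Or.inl rfl, hgR⟩
        · exact Or.inr ⟨hxR, fun h => hgR (h ▸ hxR), hxm⟩
    rw [e]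
    exact hmem

end PercRepro.MSTight
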